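/-
Copyright (c) 2026 the pub-hodgecm-mathlib formalisation cell (harness21).  Prover seat hodgecm-mathlib-K2Liu-p27 (g0), Track B «K2-LIT»,
#184♮ = hLiu418 = `stmt-HodgeConjecture-24832`; #42S organ S2, (B) CONJUGACY of the archimedean compacts of standard Iwasawa data, file B1 (pure linear algebra)
(desk K2Liu-p05 (g6) 2026-09-04T15:34:14Z «(B) GO»; LEAD F0P6-plan (g14) BATCH #45∕#46).
-/
import Mathlib.Analysis.Matrix.Order
import Mathlib.Analysis.SpecialFunctions.ContinuousFunctionalCalculus.Rpow.Basic
import Mathlib.LinearAlgebra.UnitaryGroup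
import HarnessLib

/-!
# Crux `HLiu418`, #42S organ S2, (B) file B1: TWO MAJORANT STABILISERS IN `U(H)` ARE CONJUGATE BY AN ELEMENT OF `U(H)`

Cell `hodgecm-mathlib`, crux item hLiu418 = `stmt-HodgeConjecture-24832`; squad K2 ∕ K2Liu; LEAD F0P6-plan (g14), co-dealer K2E5-plan (g7), S2 desk K2Liu-p05 (g6); prover
K2Liu-p27 (g0).  THEOREMS ONLY (no `def`, no instance, no notation, no named-fact hypothesis, no `sorry`); lane `--supports stmt-HodgeConjecture-24832 --as helper`.
Pure linear algebra over `ℂ` (Mathlib only), generic finite index type `m`.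

WHY (census K2Liu-p27 (g0) 2026-09-04T15:33:43Z, desk «=» 15:34:14Z).  A STANDARD Iwasawa datum (Literature ★ `IwasawaDatum.IsStd`, (P2)) has archimedean part
`C_∞ = {a ∈ U(H) | S⁻¹ a S ∈ U(m)}` = the stabiliser in `U(H)` of the positive MAJORANT `Q_S = (S S^*)⁻¹`, for SOME frame `S ∈ GL_m(ℂ)` (per complex place) with the
majorant identity `J′ · J′ = 1`, `J′ = Sᴴ H S`.  The S2 letters (σ15's place sections, p16's reading frames) all live in the stabiliser of the DIAGONAL majorant `|H|`
(frame `S₂ = |H|^{-1∕2}`), and the tree's own datum `K₉` uses the antidiagonal frame — a DIFFERENT majorant.  This file proves that ANY two majorant stabilisers are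
conjugate INSIDE `U(H)`:

**`exists_conj_of_majorantFrames`** — for `H` hermitian and frames `S₁`, `S₂` (invertible, `(Sᵢᴴ H Sᵢ)² = 1`) there is `g` with `gᴴ H g = H`, `g` invertible, and
`∀ a, S₁⁻¹ a S₁ ∈ U(m) ↔ S₂⁻¹ (g⁻¹ a g) S₂ ∈ U(m)` — i.e. `Stab(Q_{S₁}) = g · Stab(Q_{S₂}) · g⁻¹`.

PROOF (no signature counting).  `M := S₂⁻¹ S₁`, so `J₁ = Mᴴ J₂ M`.  Polar decomposition `M = W P`, `P := √(Mᴴ M) ≻ 0` (Mathlib `CFC.sqrt` in the matrix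
`C⋆`-order), `W := M P⁻¹` unitary.  `K := Wᴴ J₂ W` is a hermitian involution and `J₁ = P K P`; from `J₁² = 1`: `(K P K)² = P⁻²` with `K P K ⪰ 0`, so `K P K = P⁻¹` by
uniqueness of positive square roots (`CFC.mul_self_eq_mul_self_iff`), whence `J₁ = P K P = K = Wᴴ J₂ W` — the two majorant involutions are UNITARILY similar.  Then
`g := S₁ Wᴴ S₂⁻¹` lies in `U(H)` (`gᴴ H g = S₂⁻ᴴ (W J₁ Wᴴ) S₂⁻¹ = S₂⁻ᴴ J₂ S₂⁻¹ = H`) and `S₂⁻¹ (g⁻¹ a g) S₂ = W (S₁⁻¹ a S₁) Wᴴ`, unitary iff `S₁⁻¹ a S₁` is.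
The sequel B2 `K2LiuStdArchCompactConjugate` transports this place by place to `UnitaryGroup.arch` and the canonical sign frames (`archUFormPi`, `placeSec`).
References: [Weil1964] A. Weil, Acta Math. 111 (1964), Chap. I n° 8 (majorants of a hermitian form; the compact stabiliser); [BorelJacquet1979] §4.1; [PlatonovRapinchuk1994]
§3.2 (maximal compact subgroups of real unitary groups are conjugate); [Helgason1978] Ch. VI Thm. 1.1 (polar ∕ Cartan decomposition).
HONEST LABEL.  Count-neutral helper: `HC_CM` is proved only modulo the 7 printed citations (2 remaining named inputs: hLiu418 = `stmt-HodgeConjecture-24832`,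
h413 = `stmt-HodgeConjecture-24833`) until rung 0 closes; this file closes no socket.
-/

set_option autoImplicit false
set_option linter.dupNamespace false -- the mandated namespace repeats `HodgeConjecture.HodgeConjecture`

noncomputable section

open scoped Matrix MatrixOrder ComplexOrder

namespace Summit.HodgeConjecture.HodgeConjecture.Cruxes.HLiu418.K2LiuMajorantStabiliserConjugate

variable {m : Type*} [Fintype m] [DecidableEq m]

/-! ## §1 Unitary matrices: conjugation lemmas -/

/-- `A ∈ U(m) ↔ Aᴴ A = 1`. [folklore] -/
theorem mem_unitaryGroup_iff_conjTranspose_mul (A : Matrix m m ℂ) : A ∈ Matrix.unitaryGroup m ℂ ↔ Aᴴ * A = 1 :=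
  Matrix.mem_unitaryGroup_iff'

/-- an invertible matrix has an invertible conjugate transpose (`det Aᴴ = star (det A)`). [folklore] -/
theorem isUnit_conjTranspose {A : Matrix m m ℂ} (h : IsUnit A) : IsUnit Aᴴ := by
  rw [Matrix.isUnit_iff_isUnit_det] at h ⊢
  rw [Matrix.det_conjTranspose]
  exact h.star

/-- conjugating by a unitary `W` preserves `U(m)`: `W X Wᴴ ∈ U(m) ↔ X ∈ U(m)`. [folklore] -/
theorem conj_mem_unitaryGroup_iff {W : Matrix m m ℂ} (hW : Wᴴ * W = 1) (X : Matrix m m ℂ) :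
    W * X * Wᴴ ∈ Matrix.unitaryGroup m ℂ ↔ X ∈ Matrix.unitaryGroup m ℂ := by
  have hW' : W * Wᴴ = 1 := mul_eq_one_comm.1 hW
  have hWmem : W ∈ Matrix.unitaryGroup m ℂ := Matrix.mem_unitaryGroup_iff'.2 hW
  have hWstar : Wᴴ ∈ Matrix.unitaryGroup m ℂ :=
    Matrix.mem_unitaryGroup_iff'.2 (by rw [Matrix.star_eq_conjTranspose, Matrix.conjTranspose_conjTranspose]; exact hW')
  constructor
  · intro h
    have h' : Wᴴ * (W * X * Wᴴ) * W ∈ Matrix.unitaryGroup m ℂ := mul_mem (mul_mem hWstar h) hWmem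
    have hx : Wᴴ * (W * X * Wᴴ) * W = X := by
      calc Wᴴ * (W * X * Wᴴ) * W = (Wᴴ * W) * X * (Wᴴ * W) := by simp only [Matrix.mul_assoc]
        _ = X := by rw [hW, Matrix.one_mul, Matrix.mul_one]
    rwa [hx] at h'
  · intro h
    exact mul_mem (mul_mem hWmem h) hWstar

/-! ## §2 A positive square root squeezed by a hermitian involution -/

/-- **uniqueness of positive square roots, squeezed form**: if `P ≻ 0`, `K` is a hermitian involution (`Kᴴ = K`, `K K = 1`) and `(P K P)² = 1`, then `P K P = K`.
(`X := K P K ⪰ 0` has `X² = P⁻²`, so `X = P⁻¹`.) [cite: Helgason1978, Ch. VI Thm. 1.1] -/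
theorem mul_mul_eq_of_involution {P K : Matrix m m ℂ} (hP : P.PosDef) (hK : Kᴴ = K) (hKK : K * K = 1)
    (h : P * K * P * (P * K * P) = 1) : P * K * P = K := by
  have hPu : IsUnit P := hP.isUnit
  have hPdet : IsUnit P.det := (Matrix.isUnit_iff_isUnit_det P).1 hPu
  have hPherm : Pᴴ = P := hP.isHermitian.eq
  -- `X := K P K` is positive semidefinite and squares to `P⁻¹ P⁻¹`
  have hX0 : (K * P * K).PosSemidef := by
    have := hP.posSemidef.conjTranspose_mul_mul_same K
    rwa [hK] at this
  have hPinv : P⁻¹.PosDef := hP.inv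
  have hXX : K * P * K * (K * P * K) = P⁻¹ * P⁻¹ := by
    -- from `P K P P K P = 1`: `K P P K = P⁻¹ P⁻¹`
    have h1 : P⁻¹ * (P * K * P * (P * K * P)) * P⁻¹ = P⁻¹ * 1 * P⁻¹ := by rw [h]
    rw [Matrix.mul_one] at h1
    have h2 : P⁻¹ * (P * K * P * (P * K * P)) * P⁻¹ = K * P * P * K := by
      simp only [← Matrix.mul_assoc, Matrix.nonsing_inv_mul P hPdet, Matrix.one_mul]
      rw [Matrix.mul_assoc (K * P * P * K), Matrix.mul_nonsing_inv P hPdet, Matrix.mul_one]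
    rw [h2] at h1
    calc K * P * K * (K * P * K) = K * P * (K * K) * P * K := by simp only [Matrix.mul_assoc]
      _ = K * P * P * K := by rw [hKK, Matrix.mul_one]
      _ = P⁻¹ * P⁻¹ := h1
  -- uniqueness of the positive square root in the matrix `C⋆`-order
  have hXeq : K * P * K = P⁻¹ := by
    have hx : (0 : Matrix m m ℂ) ≤ K * P * K := Matrix.nonneg_iff_posSemidef.2 hX0
    have hy : (0 : Matrix m m ℂ) ≤ P⁻¹ := Matrix.nonneg_iff_posSemidef.2 hPinv.posSemidef
    exact (CFC.mul_self_eq_mul_self_iff (K * P * K) P⁻¹ hx hy).1 hXX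
  -- `K P = P⁻¹ K`, hence `P K P = K`
  have hKP : K * P = P⁻¹ * K := by
    have := congrArg (· * K) hXeq
    simpa only [Matrix.mul_assoc, hKK, Matrix.mul_one] using this
  calc P * K * P = P * (K * P) := Matrix.mul_assoc _ _ _
    _ = P * (P⁻¹ * K) := by rw [hKP]
    _ = K := by rw [← Matrix.mul_assoc, Matrix.mul_nonsing_inv P hPdet, Matrix.one_mul]

/-! ## §3 Two majorant involutions are unitarily similar; the stabilisers are conjugate in `U(H)` -/

/-- **polar decomposition data**: for an invertible `M` there are `P ≻ 0` and `W` unitary (`Wᴴ W = 1`) with `M = W P` (`P := √(Mᴴ M)`). [cite: Helgason1978, Ch. VI Thm. 1.1] -/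
theorem exists_polar {M : Matrix m m ℂ} (hM : IsUnit M) :
    ∃ W P : Matrix m m ℂ, P.PosDef ∧ Wᴴ * W = 1 ∧ M = W * P := by
  have hMdet : IsUnit M.det := (Matrix.isUnit_iff_isUnit_det M).1 hM
  have hN : (Mᴴ * M).PosDef := Matrix.PosDef.conjTranspose_mul_self M (Matrix.mulVec_injective_of_isUnit hM)
  have hN0 : (0 : Matrix m m ℂ) ≤ Mᴴ * M := Matrix.nonneg_iff_posSemidef.2 hN.posSemidef
  set P : Matrix m m ℂ := CFC.sqrt (Mᴴ * M) with hPdef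
  have hP0 : (0 : Matrix m m ℂ) ≤ P := CFC.sqrt_nonneg _
  have hPP : P * P = Mᴴ * M := CFC.sqrt_mul_sqrt_self _ hN0
  have hPsd : P.PosSemidef := Matrix.nonneg_iff_posSemidef.1 hP0
  have hPu : IsUnit P := (CFC.isUnit_sqrt_iff (Mᴴ * M) hN0).2 hN.isUnit
  have hPdet : IsUnit P.det := (Matrix.isUnit_iff_isUnit_det P).1 hPu
  have hPd : P.PosDef := (hPsd.posDef_iff_isUnit).2 hPu
  have hPherm : Pᴴ = P := hPsd.isHermitian.eq
  refine ⟨M * P⁻¹, P, hPd, ?_, ?_⟩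
  · -- `(M P⁻¹)ᴴ (M P⁻¹) = P⁻¹ (Mᴴ M) P⁻¹ = P⁻¹ P P P⁻¹ = 1`
    rw [Matrix.conjTranspose_mul, Matrix.conjTranspose_nonsing_inv, hPherm]
    calc P⁻¹ * Mᴴ * (M * P⁻¹) = P⁻¹ * (Mᴴ * M) * P⁻¹ := by simp only [Matrix.mul_assoc]
      _ = P⁻¹ * (P * P) * P⁻¹ := by rw [hPP]
      _ = 1 := by rw [← Matrix.mul_assoc, Matrix.nonsing_inv_mul P hPdet, Matrix.one_mul, Matrix.mul_nonsing_inv P hPdet]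
  · rw [Matrix.mul_assoc, Matrix.nonsing_inv_mul P hPdet, Matrix.mul_one]

/-- **two majorant involutions are unitarily similar**: if `J₂` is a hermitian involution and `J₁ := Mᴴ J₂ M` (for an invertible `M`) is also an involution, then
`J₁ = Wᴴ J₂ W` for a unitary `W` — namely the unitary factor of the polar decomposition `M = W P`. [cite: Weil1964, Chap. I n° 8] [cite: Helgason1978, Ch. VI Thm. 1.1] -/
theorem exists_unitary_conj_of_involutions {M J₂ : Matrix m m ℂ} (hM : IsUnit M) (hJ₂ : J₂ᴴ = J₂) (hJ₂J₂ : J₂ * J₂ = 1)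
    (hJ₁J₁ : Mᴴ * J₂ * M * (Mᴴ * J₂ * M) = 1) :
    ∃ W : Matrix m m ℂ, Wᴴ * W = 1 ∧ IsUnit W ∧ Mᴴ * J₂ * M = Wᴴ * J₂ * W := by
  obtain ⟨W, P, hP, hW, hMWP⟩ := exists_polar hM
  have hW' : W * Wᴴ = 1 := mul_eq_one_comm.1 hW
  have hWu : IsUnit W := (Matrix.isUnit_iff_isUnit_det W).2 (Matrix.isUnit_det_of_right_inverse hW')
  have hPherm : Pᴴ = P := hP.isHermitian.eq
  -- `K := Wᴴ J₂ W` is a hermitian involution with `J₁ = P K P`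
  have hK : (Wᴴ * J₂ * W)ᴴ = Wᴴ * J₂ * W := by
    rw [Matrix.conjTranspose_mul, Matrix.conjTranspose_mul, Matrix.conjTranspose_conjTranspose, hJ₂, Matrix.mul_assoc]
  have hKK : Wᴴ * J₂ * W * (Wᴴ * J₂ * W) = 1 := by
    calc Wᴴ * J₂ * W * (Wᴴ * J₂ * W) = Wᴴ * J₂ * (W * Wᴴ) * J₂ * W := by simp only [Matrix.mul_assoc]
      _ = 1 := by rw [hW', Matrix.mul_one, Matrix.mul_assoc Wᴴ, hJ₂J₂, Matrix.mul_one, hW]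
  have hJ₁ : Mᴴ * J₂ * M = P * (Wᴴ * J₂ * W) * P := by
    rw [hMWP, Matrix.conjTranspose_mul, hPherm]
    simp only [Matrix.mul_assoc]
  have hsq : P * (Wᴴ * J₂ * W) * P * (P * (Wᴴ * J₂ * W) * P) = 1 := by rw [← hJ₁]; exact hJ₁J₁
  refine ⟨W, hW, hWu, ?_⟩
  rw [hJ₁]
  exact mul_mul_eq_of_involution hP hK hKK hsq

/-- **TWO MAJORANT STABILISERS IN `U(H)` ARE CONJUGATE BY AN ELEMENT OF `U(H)`.**  For `H` hermitian and two frames `S₁, S₂` (invertible) with the majorant identities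
`(Sᵢᴴ H Sᵢ)² = 1`, there is `g` with `gᴴ H g = H`, `g` invertible, and `S₁⁻¹ a S₁ ∈ U(m) ↔ S₂⁻¹ (g⁻¹ a g) S₂ ∈ U(m)` for every matrix `a`: the stabiliser of the majorant
`Q_{S₁}` is the `g`-conjugate of the stabiliser of `Q_{S₂}`.  (`g := S₁ Wᴴ S₂⁻¹` with `W` from `exists_unitary_conj_of_involutions` for `M := S₂⁻¹ S₁`.)
[cite: Weil1964, Chap. I n° 8] [cite: PlatonovRapinchuk1994, §3.2] [cite: BorelJacquet1979, §4.1] -/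
theorem exists_conj_of_majorantFrames {H S₁ S₂ : Matrix m m ℂ} (hH : Hᴴ = H) (hS₁ : IsUnit S₁) (hS₂ : IsUnit S₂)
    (h₁ : S₁ᴴ * H * S₁ * (S₁ᴴ * H * S₁) = 1) (h₂ : S₂ᴴ * H * S₂ * (S₂ᴴ * H * S₂) = 1) :
    ∃ g : Matrix m m ℂ, gᴴ * H * g = H ∧ IsUnit g ∧
      ∀ a : Matrix m m ℂ, S₁⁻¹ * a * S₁ ∈ Matrix.unitaryGroup m ℂ ↔ S₂⁻¹ * (g⁻¹ * a * g) * S₂ ∈ Matrix.unitaryGroup m ℂ := by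
  have hS₁det : IsUnit S₁.det := (Matrix.isUnit_iff_isUnit_det S₁).1 hS₁
  have hS₂det : IsUnit S₂.det := (Matrix.isUnit_iff_isUnit_det S₂).1 hS₂
  have hS₂detH : IsUnit S₂ᴴ.det := (Matrix.isUnit_iff_isUnit_det S₂ᴴ).1 (isUnit_conjTranspose hS₂)
  -- the two involutions `J₂ := S₂ᴴ H S₂` and `J₁ = Mᴴ J₂ M`, `M := S₂⁻¹ S₁`
  have hJ₂ : (S₂ᴴ * H * S₂)ᴴ = S₂ᴴ * H * S₂ := by
    rw [Matrix.conjTranspose_mul, Matrix.conjTranspose_mul, Matrix.conjTranspose_conjTranspose, hH, Matrix.mul_assoc]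
  have hM : IsUnit (S₂⁻¹ * S₁) :=
    ((Matrix.isUnit_nonsing_inv_iff (A := S₂)).2 hS₂).mul hS₁
  have hMJ : (S₂⁻¹ * S₁)ᴴ * (S₂ᴴ * H * S₂) * (S₂⁻¹ * S₁) = S₁ᴴ * H * S₁ := by
    rw [Matrix.conjTranspose_mul, Matrix.conjTranspose_nonsing_inv]
    calc S₁ᴴ * S₂ᴴ⁻¹ * (S₂ᴴ * H * S₂) * (S₂⁻¹ * S₁)
        = S₁ᴴ * (S₂ᴴ⁻¹ * S₂ᴴ) * H * (S₂ * S₂⁻¹) * S₁ := by simp only [Matrix.mul_assoc]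
      _ = S₁ᴴ * H * S₁ := by
        rw [Matrix.nonsing_inv_mul _ hS₂detH, Matrix.mul_one,
          Matrix.mul_nonsing_inv _ hS₂det, Matrix.mul_one]
  have hJ₁J₁ : (S₂⁻¹ * S₁)ᴴ * (S₂ᴴ * H * S₂) * (S₂⁻¹ * S₁) * ((S₂⁻¹ * S₁)ᴴ * (S₂ᴴ * H * S₂) * (S₂⁻¹ * S₁)) = 1 := by
    rw [hMJ]; exact h₁
  obtain ⟨W, hW, hWu, hsim⟩ := exists_unitary_conj_of_involutions hM hJ₂ h₂ hJ₁J₁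
  rw [hMJ] at hsim
  have hW' : W * Wᴴ = 1 := mul_eq_one_comm.1 hW
  have hWdet : IsUnit W.det := (Matrix.isUnit_iff_isUnit_det W).1 hWu
  have hWinv : W⁻¹ = Wᴴ := Matrix.inv_eq_left_inv hW
  -- the conjugator
  refine ⟨S₁ * Wᴴ * S₂⁻¹, ?_, ?_, fun a => ?_⟩
  · -- `gᴴ H g = S₂⁻ᴴ (W J₁ Wᴴ) S₂⁻¹ = S₂⁻ᴴ J₂ S₂⁻¹ = H`
    rw [Matrix.conjTranspose_mul, Matrix.conjTranspose_mul, Matrix.conjTranspose_conjTranspose, Matrix.conjTranspose_nonsing_inv]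
    calc S₂ᴴ⁻¹ * (W * S₁ᴴ) * H * (S₁ * Wᴴ * S₂⁻¹)
        = S₂ᴴ⁻¹ * (W * (S₁ᴴ * H * S₁) * Wᴴ) * S₂⁻¹ := by simp only [Matrix.mul_assoc]
      _ = S₂ᴴ⁻¹ * (W * (Wᴴ * (S₂ᴴ * H * S₂) * W) * Wᴴ) * S₂⁻¹ := by rw [hsim]
      _ = S₂ᴴ⁻¹ * ((W * Wᴴ) * (S₂ᴴ * H * S₂) * (W * Wᴴ)) * S₂⁻¹ := by simp only [Matrix.mul_assoc]
      _ = (S₂ᴴ⁻¹ * S₂ᴴ) * H * (S₂ * S₂⁻¹) := by rw [hW', Matrix.one_mul, Matrix.mul_one]; simp only [Matrix.mul_assoc]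
      _ = H := by
        rw [Matrix.nonsing_inv_mul _ hS₂detH, Matrix.one_mul,
          Matrix.mul_nonsing_inv _ hS₂det, Matrix.mul_one]
  · exact (hS₁.mul (isUnit_conjTranspose hWu)).mul ((Matrix.isUnit_nonsing_inv_iff (A := S₂)).2 hS₂)
  · -- `S₂⁻¹ (g⁻¹ a g) S₂ = W (S₁⁻¹ a S₁) Wᴴ`
    have hg : (S₁ * Wᴴ * S₂⁻¹)⁻¹ = S₂ * W * S₁⁻¹ := by
      rw [Matrix.mul_inv_rev, Matrix.mul_inv_rev, Matrix.nonsing_inv_nonsing_inv S₂ hS₂det, ← hWinv,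
        Matrix.nonsing_inv_nonsing_inv W hWdet, Matrix.mul_assoc]
    have hconj : S₂⁻¹ * ((S₁ * Wᴴ * S₂⁻¹)⁻¹ * a * (S₁ * Wᴴ * S₂⁻¹)) * S₂ = W * (S₁⁻¹ * a * S₁) * Wᴴ := by
      rw [hg]
      calc S₂⁻¹ * (S₂ * W * S₁⁻¹ * a * (S₁ * Wᴴ * S₂⁻¹)) * S₂
          = (S₂⁻¹ * S₂) * W * S₁⁻¹ * a * S₁ * Wᴴ * (S₂⁻¹ * S₂) := by simp only [Matrix.mul_assoc]
        _ = W * (S₁⁻¹ * a * S₁) * Wᴴ := by rw [Matrix.nonsing_inv_mul _ hS₂det, Matrix.one_mul, Matrix.mul_one]; simp only [Matrix.mul_assoc]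
    rw [hconj, conj_mem_unitaryGroup_iff hW]

end Summit.HodgeConjecture.HodgeConjecture.Cruxes.HLiu418.K2LiuMajorantStabiliserConjugate

end
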